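import Literature.InformationTheory.QuantumCodes.TwoBlockGACodeEquivalences
import HarnessLib

/-!
# Two-block group-algebra codes: the census equivalence classes carry `[[n,k,d]]`
# (Lin–Pryadko 2024, Theorem 6 — unified two-sided translations, `IsCode` and pointwise transport)

Lin–Pryadko [LinPryadko2024, §4.2 Theorem 6] (held text arXiv:2306.16400 chunk p0009 L72–98; proof App.,
chunk p0018 L3–50) list the permutation equivalences of the 2BGA code `LP[a,b]` over an ARBITRARY finite
group; `TwoBlockGACodeEquivalences.lean` proves items (i), (ii), (iv), (v), (vi) on `TwoBlockGA.css a b`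
as equalities of `d^X`, `d^Z`, `k`. Their §5 enumeration (chunk p0013 L24–38: "we discarded all pairs
where `αaβ < a` or `αbβ < b` for any `α, β ∈ G` … with `W_a = W_b`, we discarded the pairs with `b̂ < a`")
— and the qec census cell A.6′ (non-abelian groups, CENSUS-PREREG v1.6 P3.17: weak classes "two-sided
translations × `Aut(G)` × swap-with-inversion") — use Theorem 6 in the following forms, added here on top
of that file (no statement of it is repeated):

* **(ii)+(iv) as ONE four-parameter family**: `LP[a,b] ≅ LP[g·a·h, g'·b·h']` for all `g, h, g', h' ∈ G`
  INDEPENDENTLY (`biTranslate g h a = (x ↦ a(gxh))`, the coefficient vector of `g⁻¹ a h⁻¹ ∈ 𝔽₂[G]`;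
  `rTranslate`, `lTranslate`, `conj` of the previous file are the cases `(1, α⁻¹)`, `(β⁻¹, 1)`, `(α, α⁻¹)`),
  with the single explicit re-indexing: `X`-checks `γ ↦ gγh'`, `Z`-checks `γ ↦ h⁻¹γg'⁻¹`, qubits
  `L δ ↦ L(h⁻¹δh')`, `R δ ↦ R(gδg'⁻¹)` — `HX_biTranslate`, `HZ_biTranslate`, `css_biTranslate_dX/dZ/k`;
* **the census predicate** `CSSCode.IsCode n k d` is invariant under every item: `css_biTranslate_isCode_iff`,
  `css_mapEquiv_isCode_iff`, `css_conj_isCode_iff`, `css_translate_isCode_iff`, `css_hatSwap_isCode_iff`,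
  `css_hat_isCode_iff`, `css_isCode_iff_swapBlocks` (the last two through `CSSCode.swap_isCode_iff`: the
  `X ↔ Z` exchange does not change `[[n,k,d]]`);
* **(vi) in matrix form and pointwise**: `H_X(b,a)`, `H_Z(b,a)` ARE `H_Z(a,b)`, `H_X(a,b)` with checks and
  qubits inverted (`HX_swapBlocks`, `HZ_swapBlocks`), so a `Z`-side lower-bound certificate / weight witness
  for `LP[b,a]` is an `X`-side one for `LP[a,b]` (`xLowerBound_of_zLowerBound_swapBlocks`,
  `xWitness_of_zWitness_swapBlocks`) — the operational content of `css_dX_eq_dZ_swapBlocks` for kernels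
  that certify one side only.

All statements PROVED (FACT P of `CSSEquivalence.lean`); no named facts; nothing about a specific code.

## References (locators read on the page via `lit read arxiv:2306.16400`, held corpus-tex copy)

* [LinPryadko2024] H.-K. Lin, L. P. Pryadko, *Quantum two-block group algebra codes*, Phys. Rev. A 109
  (2024) 022407 = arXiv:2306.16400: §4.2 Theorem 6 (chunk p0009 L66–98); App. proof of Theorem 6
  (chunk p0018 L3–50: (ii) "`S = L(α⁻¹)R(β)` and remember that `L` and `R` matrices commute", (iv)
  "`A' = AL`, `B' = BR` … a consequence of commutativity of left and right matrices"); §5 (chunk p0013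
  L24–38: enumeration modulo these equivalences).
-/

namespace Literature.InformationTheory.QuantumCodes

open Matrix

/-! ### The `X ↔ Z` exchange preserves the census predicate -/

namespace CSSCode

variable {RX RZ Q : Type*} [Fintype Q] [Fintype RX] [Fintype RZ]

/-- `C.swap` is `[[n,k,d]]` iff `C` is (`k` and `cssMinDist = min(d^X,d^Z)` are symmetric in the two
check matrices). [cite: Gottesman1997, §3.3 (the two parity check matrices enter symmetrically)] -/
theorem swap_isCode_iff (C : CSSCode RX RZ Q) (n k d : ℕ) : C.swap.IsCode n k d ↔ C.IsCode n k d := by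
  unfold IsCode
  rw [k_swap, swap_HX, swap_HZ, cssMinDist_comm]

end CSSCode

namespace TwoBlockGA

variable {G : Type*} [Group G] {R : Type*}

/-! ### Two-sided translates `x ↦ a(g x h)` -/

/-- The coefficient vector `x ↦ a(g x h)` — that of the two-sided translate `g⁻¹ · a · h⁻¹ ∈ F[G]`; as
`g, h` range over `G` these are all two-sided translates `α a β`.
[cite: LinPryadko2024, §4.2 Thm 6 (ii),(iv) and §5 "we discarded all pairs where αaβ < a or αbβ < b" (arXiv:2306.16400 chunk p0009 L80–84, p0013 L29–32)] -/
def biTranslate (g h : G) (a : G → R) : G → R := fun x => a (g * x * h)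

/-- `biTranslate g h a x = a (g * x * h)`. [cite: LinPryadko2024, §4.2 Thm 6 (ii),(iv) (arXiv:2306.16400 chunk p0009 L80–84)] -/
@[simp] theorem biTranslate_apply (g h : G) (a : G → R) (x : G) : biTranslate g h a x = a (g * x * h) := rfl

/-- `biTranslate 1 1 a = a`. [cite: LinPryadko2024, §4.2 Thm 6 (arXiv:2306.16400 chunk p0009 L80–84)] -/
@[simp] theorem biTranslate_one_one (a : G → R) : biTranslate 1 1 a = a := by
  funext x; simp

/-- Composition of two-sided translates: `biTranslate g h (biTranslate g' h' a) = biTranslate (g'g) (hh') a`.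
[cite: LinPryadko2024, §4.2 Thm 6 (ii),(iv) (arXiv:2306.16400 chunk p0009 L80–84)] -/
theorem biTranslate_biTranslate (g h g' h' : G) (a : G → R) :
    biTranslate g h (biTranslate g' h' a) = biTranslate (g' * g) (h * h') a := by
  funext x; simp [mul_assoc]

/-- Theorem 6 (iv)'s `aα` (`rTranslate`) is the case `(g, h) = (1, α⁻¹)`.
[cite: LinPryadko2024, §4.2 Thm 6 (iv) (arXiv:2306.16400 chunk p0009 L84)] -/
theorem rTranslate_eq_biTranslate (α : G) (a : G → ZMod 2) : rTranslate α a = biTranslate 1 α⁻¹ a := by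
  funext x; simp

/-- Theorem 6 (iv)'s `βb` (`lTranslate`) is the case `(g, h) = (β⁻¹, 1)`.
[cite: LinPryadko2024, §4.2 Thm 6 (iv) (arXiv:2306.16400 chunk p0009 L84)] -/
theorem lTranslate_eq_biTranslate (β : G) (b : G → ZMod 2) : lTranslate β b = biTranslate β⁻¹ 1 b := by
  funext x; simp

/-- Theorem 6 (ii)'s `α⁻¹aα` (`conj`) is the case `(g, h) = (α, α⁻¹)`.
[cite: LinPryadko2024, §4.2 Thm 6 (ii) (arXiv:2306.16400 chunk p0009 L80)] -/
theorem conj_eq_biTranslate (α : G) (a : G → ZMod 2) : conj α a = biTranslate α α⁻¹ a := by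
  funext x; simp

/-! ### (ii)+(iv) unified: independent two-sided translations of `a` and of `b` -/

section BiTranslate

variable (g h g' h' : G)

/-- The qubit bijection: left qubit `δ ↦ h⁻¹ δ h'`, right qubit `δ ↦ g δ g'⁻¹`.
[cite: LinPryadko2024, App. proof of Thm 6 (ii) "S = L(α⁻¹)R(β)" and (iv) "u → Lᵀu, v → Rᵀv" (arXiv:2306.16400 chunk p0018 L19–35)] -/
def biTranslatePerm : G ⊕ G ≃ G ⊕ G :=
  Equiv.sumCongr ((Equiv.mulLeft h⁻¹).trans (Equiv.mulRight h'))
    ((Equiv.mulLeft g).trans (Equiv.mulRight g'⁻¹))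

/-- The `X`-check bijection: `γ ↦ g γ h'`. [cite: LinPryadko2024, App. proof of Thm 6 (ii),(iv) (arXiv:2306.16400 chunk p0018 L19–35)] -/
def biTranslateRowX : G ≃ G := (Equiv.mulLeft g).trans (Equiv.mulRight h')

/-- The `Z`-check bijection: `γ ↦ h⁻¹ γ g'⁻¹`. [cite: LinPryadko2024, App. proof of Thm 6 (ii),(iv) (arXiv:2306.16400 chunk p0018 L19–41)] -/
def biTranslateRowZ : G ≃ G := (Equiv.mulLeft h⁻¹).trans (Equiv.mulRight g'⁻¹)

/-- `H_X` of the pair `(g·a·h, g'·b·h')` is `H_X(a,b)` re-indexed: `X`-checks by `γ ↦ gγh'`, qubits by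
`biTranslatePerm`. [cite: LinPryadko2024, App. proof of Thm 6 (ii),(iv) (arXiv:2306.16400 chunk p0018 L19–35)] -/
theorem HX_biTranslate (a b : G → R) :
    HX (biTranslate g h a) (biTranslate g' h' b) =
      (HX a b).submatrix (biTranslateRowX g h') (biTranslatePerm g h g' h') := by
  ext γ (δ | δ)
  · simp only [HX_apply_inl, biTranslate_apply, submatrix_apply, biTranslateRowX, biTranslatePerm,
      Equiv.trans_apply, Equiv.coe_mulLeft, Equiv.coe_mulRight, Equiv.sumCongr_apply, Sum.map_inl]
    congr 1
    group
  · simp only [HX_apply_inr, biTranslate_apply, submatrix_apply, biTranslateRowX, biTranslatePerm,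
      Equiv.trans_apply, Equiv.coe_mulLeft, Equiv.coe_mulRight, Equiv.sumCongr_apply, Sum.map_inr]
    congr 1
    group

/-- `H_Z` of the pair `(g·a·h, g'·b·h')` is `H_Z(a,b)` re-indexed: `Z`-checks by `γ ↦ h⁻¹γg'⁻¹`, qubits by
the SAME `biTranslatePerm`. [cite: LinPryadko2024, App. proof of Thm 6 (iv) "H_Z' c_X' = RᵀLᵀ(Bᵀ,−Aᵀ)(u_X;v_X) = 0" (arXiv:2306.16400 chunk p0018 L28–41)] -/
theorem HZ_biTranslate (a b : G → R) :
    HZ (biTranslate g h a) (biTranslate g' h' b) =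
      (HZ a b).submatrix (biTranslateRowZ h g') (biTranslatePerm g h g' h') := by
  ext γ (δ | δ)
  · simp only [HZ_apply_inl, biTranslate_apply, submatrix_apply, biTranslateRowZ, biTranslatePerm,
      Equiv.trans_apply, Equiv.coe_mulLeft, Equiv.coe_mulRight, Equiv.sumCongr_apply, Sum.map_inl]
    congr 1
    group
  · simp only [HZ_apply_inr, biTranslate_apply, submatrix_apply, biTranslateRowZ, biTranslatePerm,
      Equiv.trans_apply, Equiv.coe_mulLeft, Equiv.coe_mulRight, Equiv.sumCongr_apply, Sum.map_inr]
    congr 1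
    group

variable [Fintype G]

/-- **Independent two-sided translations preserve `d^X`**: `d^X(LP[g·a·h, g'·b·h']) = d^X(LP[a,b])` for all
`g, h, g', h'` and every finite group. [cite: LinPryadko2024, §4.2 Thm 6 (ii),(iv) (arXiv:2306.16400 chunk p0009 L80–84)] -/
theorem css_biTranslate_dX (a b : G → ZMod 2) :
    (css (biTranslate g h a) (biTranslate g' h' b)).dX = (css a b).dX :=
  CSSCode.dX_eq_of_submatrix (C := css a b) (C' := css (biTranslate g h a) (biTranslate g' h' b))
    (HX_biTranslate g h g' h' a b) (HZ_biTranslate g h g' h' a b)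

/-- **Independent two-sided translations preserve `d^Z`**. [cite: LinPryadko2024, §4.2 Thm 6 (ii),(iv) (arXiv:2306.16400 chunk p0009 L80–84)] -/
theorem css_biTranslate_dZ (a b : G → ZMod 2) :
    (css (biTranslate g h a) (biTranslate g' h' b)).dZ = (css a b).dZ :=
  CSSCode.dZ_eq_of_submatrix (C := css a b) (C' := css (biTranslate g h a) (biTranslate g' h' b))
    (HX_biTranslate g h g' h' a b) (HZ_biTranslate g h g' h' a b)

/-- **Independent two-sided translations preserve `k`**. [cite: LinPryadko2024, §4.2 Thm 6 (ii),(iv) (arXiv:2306.16400 chunk p0009 L80–84)] -/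
theorem css_biTranslate_k (a b : G → ZMod 2) :
    (css (biTranslate g h a) (biTranslate g' h' b)).k = (css a b).k :=
  CSSCode.k_eq_of_submatrix (C := css a b) (C' := css (biTranslate g h a) (biTranslate g' h' b))
    (HX_biTranslate g h g' h' a b) (HZ_biTranslate g h g' h' a b)

/-- **Independent two-sided translations preserve `[[n,k,d]]`**. [cite: LinPryadko2024, §4.2 Thm 6 (ii),(iv) (arXiv:2306.16400 chunk p0009 L80–84)] -/
theorem css_biTranslate_isCode_iff [DecidableEq G] (a b : G → ZMod 2) (n k d : ℕ) :
    (css (biTranslate g h a) (biTranslate g' h' b)).IsCode n k d ↔ (css a b).IsCode n k d :=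
  CSSCode.isCode_iff_of_submatrix (C := css a b) (C' := css (biTranslate g h a) (biTranslate g' h' b))
    (HX_biTranslate g h g' h' a b) (HZ_biTranslate g h g' h' a b) n k d

end BiTranslate

/-! ### `[[n,k,d]]` is invariant under each item of Theorem 6 -/

section IsCode

variable [Fintype G] [DecidableEq G]

/-- **(i)** `LP[φa, φb]` is `[[n,k,d]]` iff `LP[a,b]` is, for a group isomorphism `φ : G ≃* G'`.
[cite: LinPryadko2024, §4.2 Thm 6 (i) (arXiv:2306.16400 chunk p0009 L77–78)] -/
theorem css_mapEquiv_isCode_iff {G' : Type*} [Group G'] [Fintype G'] [DecidableEq G'] (a b : G → ZMod 2)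
    (φ : G ≃* G') (n k d : ℕ) :
    (css (a ∘ φ.symm) (b ∘ φ.symm)).IsCode n k d ↔ (css a b).IsCode n k d :=
  CSSCode.isCode_iff_of_submatrix (C := css a b) (C' := css (a ∘ φ.symm) (b ∘ φ.symm))
    (HX_mapEquiv a b φ) (HZ_mapEquiv a b φ) n k d

/-- **(ii)** `LP[α⁻¹aα, β⁻¹bβ]` is `[[n,k,d]]` iff `LP[a,b]` is. [cite: LinPryadko2024, §4.2 Thm 6 (ii) (arXiv:2306.16400 chunk p0009 L80)] -/
theorem css_conj_isCode_iff (a b : G → ZMod 2) (α β : G) (n k d : ℕ) :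
    (css (conj α a) (conj β b)).IsCode n k d ↔ (css a b).IsCode n k d :=
  CSSCode.isCode_iff_of_submatrix (C := css a b) (C' := css (conj α a) (conj β b)) (HX_conj a b α β)
    (HZ_conj a b α β) n k d

/-- **(iv)** `LP[aα, βb]` is `[[n,k,d]]` iff `LP[a,b]` is. [cite: LinPryadko2024, §4.2 Thm 6 (iv) (arXiv:2306.16400 chunk p0009 L84)] -/
theorem css_translate_isCode_iff (a b : G → ZMod 2) (α β : G) (n k d : ℕ) :
    (css (rTranslate α a) (lTranslate β b)).IsCode n k d ↔ (css a b).IsCode n k d :=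
  CSSCode.isCode_iff_of_submatrix (C := css a b) (C' := css (rTranslate α a) (lTranslate β b))
    (HX_translate a b α β) (HZ_translate a b α β) n k d

/-- **(v)** `LP[b̂, â]` is `[[n,k,d]]` iff `LP[a,b]` is. [cite: LinPryadko2024, §4.2 Thm 6 (v) (arXiv:2306.16400 chunk p0009 L86)] -/
theorem css_hatSwap_isCode_iff (a b : G → ZMod 2) (n k d : ℕ) :
    (css (hat b) (hat a)).IsCode n k d ↔ (css a b).IsCode n k d :=
  CSSCode.isCode_iff_of_submatrix (C := css a b) (C' := css (hat b) (hat a)) (HX_hatSwap a b)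
    (HZ_hatSwap a b) n k d

/-- **(vi)** `LP[â, b̂]` (the CSS-dual up to the block exchange) is `[[n,k,d]]` iff `LP[a,b]` is.
[cite: LinPryadko2024, §4.2 Thm 6 (vi) (arXiv:2306.16400 chunk p0009 L88–91)] -/
theorem css_hat_isCode_iff (a b : G → ZMod 2) (n k d : ℕ) :
    (css (hat a) (hat b)).IsCode n k d ↔ (css a b).IsCode n k d := by
  rw [← CSSCode.swap_isCode_iff (css a b) n k d]
  exact (CSSCode.isCode_iff_of_submatrix (C := css (hat a) (hat b)) (C' := (css a b).swap)
    (swap_HX_eq_submatrix_hat a b) (swap_HZ_eq_submatrix_hat a b) n k d).symm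

end IsCode

/-! ### (vi) in matrix form: `LP[b,a]` is the `X ↔ Z` exchange of `LP[a,b]`, inverted -/

/-- `H_X(b, a) = [L(b) | R(a)]` is `H_Z(a,b) = [R(b)ᵀ | L(a)ᵀ]` with checks and both qubit blocks inverted
(`γ ↦ γ⁻¹`): the printed `LP[b,a] ≅` CSS-dual of `LP[a,b]`, as one explicit re-indexing.
[cite: LinPryadko2024, §4.2 Thm 6 (vi) "is permutation-equivalent to LP[â, −b̂] ≅ LP[b,a]" (arXiv:2306.16400 chunk p0009 L88–91)] -/
theorem HX_swapBlocks (a b : G → R) :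
    HX b a = (HZ a b).submatrix (Equiv.inv G) (Equiv.sumCongr (Equiv.inv G) (Equiv.inv G)) := by
  ext γ (δ | δ)
  · simp
  · simp

/-- `H_Z(b, a) = [R(a)ᵀ | L(b)ᵀ]` is `H_X(a,b)` with checks and both qubit blocks inverted.
[cite: LinPryadko2024, §4.2 Thm 6 (vi) (arXiv:2306.16400 chunk p0009 L88–91)] -/
theorem HZ_swapBlocks (a b : G → R) :
    HZ b a = (HX a b).submatrix (Equiv.inv G) (Equiv.sumCongr (Equiv.inv G) (Equiv.inv G)) := by
  ext γ (δ | δ)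
  · simp
  · simp

section SwapBlocks

variable [Fintype G]

/-- **`LP[b,a]` is `[[n,k,d]]` iff `LP[a,b]` is**, for every finite group (the census parameters do not
see which side is which, although for non-abelian `G` the swap exchanges `d^X` and `d^Z`,
`css_dX_eq_dZ_swapBlocks`). [cite: LinPryadko2024, §4.2 Thm 6 (vi) and the remark after Thm 6 (arXiv:2306.16400 chunk p0009 L88–98)] -/
theorem css_isCode_iff_swapBlocks [DecidableEq G] (a b : G → ZMod 2) (n k d : ℕ) :
    (css a b).IsCode n k d ↔ (css b a).IsCode n k d :=
  ((CSSCode.isCode_iff_of_submatrix (C := (css a b).swap) (C' := css b a) (HX_swapBlocks a b)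
    (HZ_swapBlocks a b) n k d).trans (CSSCode.swap_isCode_iff _ n k d)).symm

/-- Pointwise transport, universal form — what a `Z`-side LOWER-BOUND certificate on `LP[b,a]` delivers
for `LP[a,b]`: if every `Z`-logical of `LP[b,a]` has weight `≥ d`, then every `X`-logical of `LP[a,b]` has
weight `≥ d`. [cite: LinPryadko2024, §4.2 Thm 6 (vi) (arXiv:2306.16400 chunk p0009 L88–91)] -/
theorem xLowerBound_of_zLowerBound_swapBlocks (a b : G → ZMod 2) {d : ℕ}
    (h : ∀ w : G ⊕ G → ZMod 2, (css b a).HX *ᵥ w = 0 → w ∉ (css b a).rowSpZ → d ≤ hammingNorm w) :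
    ∀ v : G ⊕ G → ZMod 2, (css a b).HZ *ᵥ v = 0 → v ∉ (css a b).rowSpX → d ≤ hammingNorm v :=
  CSSCode.zLowerBound_of_submatrix (C := (css a b).swap) (C' := css b a) (HX_swapBlocks a b)
    (HZ_swapBlocks a b) h

/-- Pointwise transport, existential form — what a `Z`-side weight WITNESS on `LP[b,a]` delivers: a
weight-`d` `Z`-logical of `LP[b,a]` yields a weight-`d` `X`-logical of `LP[a,b]`.
[cite: LinPryadko2024, §4.2 Thm 6 (vi) (arXiv:2306.16400 chunk p0009 L88–91)] -/
theorem xWitness_of_zWitness_swapBlocks (a b : G → ZMod 2) {d : ℕ}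
    (h : ∃ w : G ⊕ G → ZMod 2, (css b a).HX *ᵥ w = 0 ∧ w ∉ (css b a).rowSpZ ∧ hammingNorm w = d) :
    ∃ v : G ⊕ G → ZMod 2, (css a b).HZ *ᵥ v = 0 ∧ v ∉ (css a b).rowSpX ∧ hammingNorm v = d :=
  CSSCode.zWitness_of_submatrix (C := (css a b).swap) (C' := css b a) (HX_swapBlocks a b)
    (HZ_swapBlocks a b) h

/-- Conversely a `Z`-side statement about `LP[a,b]` from an `X`-side certificate on `LP[b,a]`: if every
`X`-logical of `LP[b,a]` has weight `≥ d`, then every `Z`-logical of `LP[a,b]` has weight `≥ d`.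
[cite: LinPryadko2024, §4.2 Thm 6 (vi) (arXiv:2306.16400 chunk p0009 L88–91)] -/
theorem zLowerBound_of_xLowerBound_swapBlocks (a b : G → ZMod 2) {d : ℕ}
    (h : ∀ w : G ⊕ G → ZMod 2, (css b a).HZ *ᵥ w = 0 → w ∉ (css b a).rowSpX → d ≤ hammingNorm w) :
    ∀ v : G ⊕ G → ZMod 2, (css a b).HX *ᵥ v = 0 → v ∉ (css a b).rowSpZ → d ≤ hammingNorm v :=
  CSSCode.xLowerBound_of_submatrix (C := (css a b).swap) (C' := css b a) (HX_swapBlocks a b)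
    (HZ_swapBlocks a b) h

/-- `min (d^X, d^Z)` is invariant under the block swap, for every finite group.
[cite: LinPryadko2024, §4.2 Thm 6 (vi) (arXiv:2306.16400 chunk p0009 L88–91)] -/
theorem css_swapBlocks_min_dX_dZ (a b : G → ZMod 2) :
    min (css b a).dX (css b a).dZ = min (css a b).dX (css a b).dZ := by
  rw [← css_dZ_eq_dX_swapBlocks a b, ← css_dX_eq_dZ_swapBlocks a b, min_comm]

end SwapBlocks

end TwoBlockGA

end Literature.InformationTheory.QuantumCodes
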